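import Summits.ResolutionOfSingularities.KangarooAtlas.MizutaniTruncQuot
import Mathlib.RingTheory.Ideal.Quotient.Operations
import Mathlib.Algebra.CharP.Algebra
import Mathlib.Algebra.CharP.Lemmas
import HarnessLib

/-!
# Mizutani's conjecture `m(e) = 2p^e − 1` — TOWERS `K = L(x^{1/q})` and their Hasse–Schmidt operators

Cell topic `Summits/ResolutionOfSingularities/KangarooAtlas` (pub-rosobs); namespace
`Summit.ResolutionOfSingularities.KangarooAtlas.Mizutani`.  Part of the Lean transcription of the
in-house note MIZUTANI-PROOF-g59 (AI-written, AI-audited; *AI review is weaker than expert review*; not a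
resolution theorem).  MIZUTANI-PROOF-g59 §1.1 (towers) and §1.4 (the operators `D^{(T)}`):

* `rootIdeal L x q = (Y_i^q − x_i : i)`, `RootTower L x q = L[Y]/rootIdeal` (the presentation of
  `L(x^{1/q})`), `rootGen`, the universal property `liftHom`;
* `IsRootTower L K q x a` — a field `K ⊇ L` with elements `a_i`, `a_i^q = x_i ∈ L`, such that the canonical
  map `L[Y]/(Y^q − x) → K` is bijective (i.e. `K = L(x^{1/q})` with `[K : L] = q^s`: the note's TOWER, §1.1;
  `x` `p`-independent in the application);
* the TAYLOR MORPHISM `tau : K → K[u]/(u_i^q)`, `a_i ↦ a_i + u_i` (and `sig : a_i ↦ a_i − u_i`), obtained from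
  the universal property, and the **Hasse–Schmidt operators** `hsD T y = coeff_{u^T} (tau y)` with
  `hsD_zero` (`D^{(0)} = id`), `hsD_mul` (Leibniz, §1.4), `hsD_prod_pow` (`D^{(T)} a^N = C(N,T) a^{N−T}`,
  EGA IV 16.11.2.1) — `L`-linear by construction.

References: [Mizutani1973HironakaGroupSchemes] (Remark 2.10; in-house proof §1.1, §1.4);
[Oda1983HironakaGroupSchemeII] §1; [EGAIV4] Thm. 16.11.2.
-/

open MvPolynomial

namespace Summit.ResolutionOfSingularities.KangarooAtlas.Mizutani

/-! ## The presentation `L[Y]/(Y_i^q − x_i)` -/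

section Presentation

variable (L : Type*) [Field L] {s : ℕ} (x : Fin s → L) (q : ℕ)

/-- The ideal `(Y_i^q − x_i : i)` of `L[Y_1, …, Y_s]`. [cite: Mizutani1973HironakaGroupSchemes, Remark 2.10 (in-house proof §1.1, k' = 𝕜(x^{1/q}))] -/
noncomputable def rootIdeal : Ideal (MvPolynomial (Fin s) L) :=
  Ideal.span (Set.range fun i : Fin s => (X i : MvPolynomial (Fin s) L) ^ q - C (x i))

/-- The presented algebra `L[Y]/(Y^q − x)` (a field iff `x` is `q`-independent).
[cite: Mizutani1973HironakaGroupSchemes, Remark 2.10 (in-house proof §1.1)] -/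
abbrev RootTower := MvPolynomial (Fin s) L ⧸ rootIdeal L x q

/-- The classes `ȳ_i` of the variables. [folklore] -/
noncomputable def rootGen (i : Fin s) : RootTower L x q := Ideal.Quotient.mk _ (X i)

/-- `ȳ_i^q = x_i`. [folklore] -/
theorem rootGen_pow (i : Fin s) : rootGen L x q i ^ q = algebraMap L (RootTower L x q) (x i) := by
  unfold rootGen
  rw [← map_pow, Ideal.Quotient.alg_map_eq, RingHom.comp_apply, MvPolynomial.algebraMap_eq,
    Ideal.Quotient.algebraMap_eq, Ideal.Quotient.eq]
  exact Ideal.subset_span ⟨i, rfl⟩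

variable {L x q}

/-- **Universal property**: elements `z_i` of an `L`-algebra with `z_i^q = x_i` induce
`L[Y]/(Y^q − x) → A`. [folklore] -/
noncomputable def liftHom {A : Type*} [CommRing A] [Algebra L A] (z : Fin s → A)
    (hz : ∀ i, z i ^ q = algebraMap L A (x i)) : RootTower L x q →ₐ[L] A :=
  Ideal.Quotient.liftₐ _ (aeval z) (by
    intro f hf
    refine Submodule.span_induction ?_ ?_ ?_ ?_ hf
    · rintro _ ⟨i, rfl⟩
      rw [map_sub, map_pow, aeval_X, aeval_C, hz, sub_self]
    · exact map_zero _
    · intro f g _ _ hf hg; rw [map_add, hf, hg, add_zero]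
    · intro c f _ hf; rw [smul_eq_mul, map_mul, hf, mul_zero])

/-- The lift on generators. [folklore] -/
@[simp] theorem liftHom_rootGen {A : Type*} [CommRing A] [Algebra L A] (z : Fin s → A)
    (hz : ∀ i, z i ^ q = algebraMap L A (x i)) (i : Fin s) : liftHom z hz (rootGen L x q i) = z i := by
  unfold liftHom rootGen
  rw [Ideal.Quotient.liftₐ_apply, Ideal.Quotient.lift_mk]
  exact aeval_X z i

/-- Two algebra maps out of `L[Y]/(Y^q − x)` agreeing on the generators are equal. [folklore] -/
theorem algHom_ext_rootGen {A : Type*} [CommRing A] [Algebra L A] {f g : RootTower L x q →ₐ[L] A}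
    (h : ∀ i, f (rootGen L x q i) = g (rootGen L x q i)) : f = g :=
  Ideal.Quotient.algHom_ext _ (MvPolynomial.algHom_ext fun i => h i)

end Presentation

/-! ## Towers `K = L(a)`, `a_i^q = x_i` -/

section Tower

variable (L K : Type*) [Field L] [Field K] [Algebra L K] {s : ℕ} (q : ℕ) (x : Fin s → L) (a : Fin s → K)

/-- **A tower** `K = L(x^{1/q}) ⊃ L` presented by `a_i = x_i^{1/q}`: `a_i^q = x_i` and the canonical map
`L[Y]/(Y^q − x) → K` is bijective (MIZUTANI-PROOF-g59 §1.1: the monomials `a^W`, `W` in the box, form an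
`L`-basis of `K`; equivalently `[K : L] = q^s`, `x` `p`-independent when `q = p^e`).
[cite: Mizutani1973HironakaGroupSchemes, Remark 2.10 (in-house proof §1.1, TOWERS)] -/
structure IsRootTower : Prop where
  /-- `a_i^q = x_i ∈ L` -/
  pow_eq : ∀ i, a i ^ q = algebraMap L K (x i)
  /-- `L[Y]/(Y^q − x) → K`, `Y_i ↦ a_i`, is bijective -/
  bijective : Function.Bijective (liftHom (L := L) (x := x) (q := q) a pow_eq)

variable {L K q x a}

/-- The presentation isomorphism of a tower. [folklore] -/
noncomputable def IsRootTower.equiv (h : IsRootTower L K q x a) : RootTower L x q ≃ₐ[L] K :=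
  AlgEquiv.ofBijective _ h.bijective

/-- The presentation isomorphism on generators. [folklore] -/
@[simp] theorem IsRootTower.equiv_rootGen (h : IsRootTower L K q x a) (i : Fin s) :
    h.equiv (rootGen L x q i) = a i := by
  unfold IsRootTower.equiv
  rw [AlgEquiv.ofBijective_apply]
  exact liftHom_rootGen a h.pow_eq i

/-- **Universal property of the tower**: `a_i ↦ z_i` with `z_i^q = x_i` extends to an `L`-algebra map
`K → A`. [folklore] -/
noncomputable def IsRootTower.lift (h : IsRootTower L K q x a) {A : Type*} [CommRing A] [Algebra L A]
    (z : Fin s → A) (hz : ∀ i, z i ^ q = algebraMap L A (x i)) : K →ₐ[L] A :=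
  (liftHom z hz).comp h.equiv.symm.toAlgHom

/-- The lift on generators. [folklore] -/
@[simp] theorem IsRootTower.lift_apply_gen (h : IsRootTower L K q x a) {A : Type*} [CommRing A]
    [Algebra L A] (z : Fin s → A) (hz : ∀ i, z i ^ q = algebraMap L A (x i)) (i : Fin s) :
    h.lift z hz (a i) = z i := by
  unfold IsRootTower.lift
  rw [AlgHom.comp_apply, ← h.equiv_rootGen i]
  show liftHom z hz (h.equiv.symm (h.equiv (rootGen L x q i))) = z i
  rw [AlgEquiv.symm_apply_apply, liftHom_rootGen]

/-- Two algebra maps out of a tower agreeing on the generators `a_i` are equal. [folklore] -/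
theorem IsRootTower.algHom_ext (h : IsRootTower L K q x a) {A : Type*} [CommRing A] [Algebra L A]
    {f g : K →ₐ[L] A} (hfg : ∀ i, f (a i) = g (a i)) : f = g := by
  have : f.comp h.equiv.toAlgHom = g.comp h.equiv.toAlgHom :=
    algHom_ext_rootGen fun i => by
      show f (h.equiv (rootGen L x q i)) = g (h.equiv (rootGen L x q i))
      rw [h.equiv_rootGen]; exact hfg i
  ext y
  have hy := congrArg (fun φ => φ (h.equiv.symm y)) this
  simpa using hy

end Tower

/-! ## The Taylor morphism and the Hasse–Schmidt operators of a tower -/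

section HasseSchmidt

variable {L K : Type*} [Field L] [Field K] [Algebra L K] {s : ℕ} {p e : ℕ} [hp : Fact p.Prime] [CharP K p]
  {x : Fin s → L} {a : Fin s → K}

/-- In characteristic `p`, `(c + ε u_i)^q = c^q` in `K[u]/(u^q)` for `q = p^e` (`ε = ±1`). [folklore] -/
theorem mk_C_add_smul_X_pow (c : K) (ε : ℤ) (i : Fin s) :
    (Ideal.Quotient.mk (boxIdeal (Fin s) K (p ^ e)) (C c + (ε : MvPolynomial (Fin s) K) * X i)) ^ (p ^ e) =
      Ideal.Quotient.mk (boxIdeal (Fin s) K (p ^ e)) (C (c ^ (p ^ e))) := by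
  rw [← map_pow, add_pow_char_pow, mul_pow, Ideal.Quotient.eq, map_pow]
  have hX : (X i : MvPolynomial (Fin s) K) ^ p ^ e ∈ boxIdeal (Fin s) K (p ^ e) := X_pow_mem_boxIdeal _ K _ i
  have : C c ^ p ^ e + (ε : MvPolynomial (Fin s) K) ^ p ^ e * X i ^ p ^ e - C c ^ p ^ e =
      (ε : MvPolynomial (Fin s) K) ^ p ^ e * X i ^ p ^ e := by ring
  rw [this]
  exact Ideal.mul_mem_left _ _ hX

/-- The generators of the Taylor targets: `a_i + ε u_i` satisfy the tower relation. [folklore] -/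
theorem taylorGen_pow (h : IsRootTower L K (p ^ e) x a) (ε : ℤ) (i : Fin s) :
    (Ideal.Quotient.mk (boxIdeal (Fin s) K (p ^ e)) (C (a i) + (ε : MvPolynomial (Fin s) K) * X i)) ^ (p ^ e) =
      algebraMap L (BoxQuot (Fin s) K (p ^ e)) (x i) := by
  rw [mk_C_add_smul_X_pow (a i) ε i, h.pow_eq i, Ideal.Quotient.alg_map_eq, RingHom.comp_apply,
    MvPolynomial.algebraMap_apply, Ideal.Quotient.algebraMap_eq]

/-- **The Taylor morphism** of the tower: `tau : K → K[u]/(u_i^q)`, `a_i ↦ a_i + u_i` (EGA IV 16.11.2 for the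
`p`-basis `a`; MIZUTANI-PROOF-g59 §1.4). [cite: EGAIV4, Thm. 16.11.2 (Taylor morphism of a differentially smooth algebra)] -/
noncomputable def IsRootTower.tau (h : IsRootTower L K (p ^ e) x a) : K →ₐ[L] BoxQuot (Fin s) K (p ^ e) :=
  h.lift (fun i => Ideal.Quotient.mk _ (C (a i) + ((1 : ℤ) : MvPolynomial (Fin s) K) * X i))
    (taylorGen_pow h 1)

/-- The **anti-Taylor morphism** `sig : a_i ↦ a_i − u_i` (used for the coordinate map `Ω`, since
`1 ⊗ a_i = a_i ⊗ 1 − t_i`). [cite: EGAIV4, Thm. 16.11.2] -/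
noncomputable def IsRootTower.sig (h : IsRootTower L K (p ^ e) x a) : K →ₐ[L] BoxQuot (Fin s) K (p ^ e) :=
  h.lift (fun i => Ideal.Quotient.mk _ (C (a i) + ((-1 : ℤ) : MvPolynomial (Fin s) K) * X i))
    (taylorGen_pow h (-1))

/-- `tau a_i = [a_i + u_i]`. [folklore] -/
theorem IsRootTower.tau_gen (h : IsRootTower L K (p ^ e) x a) (i : Fin s) :
    h.tau (a i) = Ideal.Quotient.mk _ (C (a i) + X i) := by
  unfold IsRootTower.tau
  rw [h.lift_apply_gen]
  simp

/-- `sig a_i = [a_i − u_i]`. [folklore] -/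
theorem IsRootTower.sig_gen (h : IsRootTower L K (p ^ e) x a) (i : Fin s) :
    h.sig (a i) = Ideal.Quotient.mk _ (C (a i) - X i) := by
  unfold IsRootTower.sig
  rw [h.lift_apply_gen]
  simp [sub_eq_add_neg]

/-- The augmentation `K[u]/(u^q) → K`, `u ↦ 0`. [folklore] -/
noncomputable def augment (s : ℕ) (K : Type*) [Field K] (q : ℕ) (hq : 1 ≤ q) :
    BoxQuot (Fin s) K q →ₐ[K] K :=
  Ideal.Quotient.liftₐ _ (aeval fun _ => (0 : K)) (by
    intro f hf
    rw [mem_boxIdeal_iff] at hf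
    rw [aeval_zero', Algebra.algebraMap_self, RingHom.id_apply, constantCoeff_eq]
    by_contra hne
    exact hf 0 (mem_support_iff.mpr hne) fun i => by simp only [Finsupp.coe_zero, Pi.zero_apply]; omega)

/-- The augmentation is the constant coefficient of the box representative. [folklore] -/
theorem augment_eq_coeff_zero {q : ℕ} (hq : 1 ≤ q) (z : BoxQuot (Fin s) K q) :
    augment s K q hq z = coeff 0 (truncQ (Fin s) K q z) := by
  obtain ⟨f, rfl⟩ := Ideal.Quotient.mk_surjective z
  unfold augment
  rw [Ideal.Quotient.liftₐ_apply, Ideal.Quotient.lift_mk, coeff_zero_truncQ_mk hq]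
  show aeval (fun _ => (0 : K)) f = coeff 0 f
  rw [aeval_zero', Algebra.algebraMap_self, RingHom.id_apply, constantCoeff_eq]

/-- `(u ↦ 0) ∘ tau = id` and `(u ↦ 0) ∘ sig = id`. [cite: EGAIV4, Thm. 16.11.2 (D_0 = 1)] -/
theorem IsRootTower.augment_tau (h : IsRootTower L K (p ^ e) x a) (y : K) :
    augment s K (p ^ e) (Nat.one_le_pow _ _ hp.out.pos) (h.tau y) = y ∧
      augment s K (p ^ e) (Nat.one_le_pow _ _ hp.out.pos) (h.sig y) = y := by
  have key : ∀ (φ : K →ₐ[L] BoxQuot (Fin s) K (p ^ e)) (ε : ℤ),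
      (∀ i, φ (a i) = Ideal.Quotient.mk _ (C (a i) + (ε : MvPolynomial (Fin s) K) * X i)) →
      ((augment s K (p ^ e) (Nat.one_le_pow _ _ hp.out.pos)).restrictScalars L).comp φ = AlgHom.id L K := by
    intro φ ε hφ
    refine h.algHom_ext fun i => ?_
    rw [AlgHom.comp_apply, AlgHom.restrictScalars_apply, hφ, AlgHom.id_apply]
    unfold augment
    rw [Ideal.Quotient.liftₐ_apply, Ideal.Quotient.lift_mk]
    show aeval (fun _ => (0 : K)) (C (a i) + (ε : MvPolynomial (Fin s) K) * X i) = a i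
    simp
  constructor
  · have := congrArg (fun ψ => ψ y) (key h.tau 1 fun i => by rw [h.tau_gen]; simp)
    simpa using this
  · have := congrArg (fun ψ => ψ y) (key h.sig (-1) fun i => by rw [h.sig_gen]; simp [sub_eq_add_neg])
    simpa using this

/-- **The Hasse–Schmidt operator `D^{(T)}`** of the tower: the `u^T`-coefficient of `tau y` in
`K[u]/(u^q)` (box representative), an `L`-linear map (MIZUTANI-PROOF-g59 §1.4; EGA IV 16.11.2).
[cite: EGAIV4, Thm. 16.11.2 (D_p := coefficient of the Taylor morphism)] -/
noncomputable def IsRootTower.hsD (h : IsRootTower L K (p ^ e) x a) (T : Fin s →₀ ℕ) : K →ₗ[L] K where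
  toFun y := coeff T (truncQ (Fin s) K (p ^ e) (h.tau y))
  map_add' y z := by rw [map_add, map_add, coeff_add]
  map_smul' l y := by
    simp only [Algebra.smul_def, RingHom.id_apply]
    rw [map_mul, AlgHom.commutes, Ideal.Quotient.alg_map_eq, RingHom.comp_apply,
      MvPolynomial.algebraMap_apply, Ideal.Quotient.algebraMap_eq, truncQ_C_mul, coeff_C_mul]

/-- `D^{(T)} y = coeff_T (box representative of tau y)`. [folklore] -/
theorem IsRootTower.hsD_apply (h : IsRootTower L K (p ^ e) x a) (T : Fin s →₀ ℕ) (y : K) :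
    h.hsD T y = coeff T (truncQ (Fin s) K (p ^ e) (h.tau y)) := rfl

/-- **`D^{(0)} = id`**. [cite: EGAIV4, Thm. 16.11.2 (D_0 = 1)] -/
theorem IsRootTower.hsD_zero (h : IsRootTower L K (p ^ e) x a) : h.hsD 0 = LinearMap.id := by
  ext y
  rw [h.hsD_apply, LinearMap.id_apply, ← augment_eq_coeff_zero]
  exact (h.augment_tau y).1

/-- The box representative of `tau y` expands in the `D^{(T)} y`. [folklore] -/
theorem IsRootTower.truncQ_tau (h : IsRootTower L K (p ^ e) x a) (y : K) :
    truncQ (Fin s) K (p ^ e) (h.tau y) = ∑ T ∈ (truncQ (Fin s) K (p ^ e) (h.tau y)).support,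
      monomial T (h.hsD T y) :=
  (truncQ (Fin s) K (p ^ e) (h.tau y)).as_sum

/-- `D^{(T)} = 0` outside the box. [folklore] -/
theorem IsRootTower.hsD_eq_zero_of_not_inBox (h : IsRootTower L K (p ^ e) x a) {T : Fin s →₀ ℕ}
    (hT : ¬ InBox (p ^ e) T) (y : K) : h.hsD T y = 0 := by
  rw [h.hsD_apply]
  by_contra hne
  exact hT (inBox_of_mem_support_truncQ _ (mem_support_iff.mpr hne))

/-- **Leibniz rule** `D^{(T)}(yz) = Σ_{T₁+T₂=T} D^{(T₁)}y · D^{(T₂)}z` for `T` in the box (MIZUTANI-PROOF-g59 §1.4;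
the Taylor morphism is multiplicative). [cite: EGAIV4, Thm. 16.11.2 (16.11.2.2)] -/
theorem IsRootTower.hsD_mul (h : IsRootTower L K (p ^ e) x a) {T : Fin s →₀ ℕ} (hT : InBox (p ^ e) T)
    (y z : K) :
    h.hsD T (y * z) = ∑ w ∈ Finset.HasAntidiagonal.antidiagonal T, h.hsD w.1 y * h.hsD w.2 z := by
  simp only [h.hsD_apply]
  rw [map_mul, truncQ_mul, coeff_trunc, if_pos hT, coeff_mul]

/-- **`D^{(T)}` on monomials in the `p`-basis**: `D^{(T)}(a^N) = C(N,T) a^{N−T}` for `T` in the box and every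
`N` (EGA IV 16.11.2.1; MIZUTANI-PROOF-g59 §1.4 "D^{(T)}(a^V) := binom(V,T) a^{V−T}, V arbitrary").
[cite: EGAIV4, Thm. 16.11.2 (16.11.2.1)] -/
theorem IsRootTower.hsD_prod_pow (h : IsRootTower L K (p ^ e) x a) {T : Fin s →₀ ℕ} (hT : InBox (p ^ e) T)
    (N : Fin s →₀ ℕ) :
    h.hsD T (∏ i, a i ^ N i) = (mchoose N T : K) * ∏ i, a i ^ (N i - T i) := by
  have htau : h.tau (∏ i, a i ^ N i) = Ideal.Quotient.mk _ (∏ i, (C (a i) + X i) ^ N i) := by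
    rw [map_prod, map_prod]
    exact Finset.prod_congr rfl fun i _ => by rw [map_pow, map_pow, h.tau_gen]
  rw [h.hsD_apply, htau, truncQ_mk, coeff_trunc, if_pos hT]
  -- `∏ (C a_i + X_i)^{N_i}` is the Taylor expansion of `X^N` evaluated at `X ↦ a`
  have key : (∏ i, (C (a i) + X i : MvPolynomial (Fin s) K) ^ N i) =
      MvPolynomial.map (eval a) (Literature.AlgebraicGeometry.Resolution.taylor K (monomial N (1 : K))) := by
    rw [monomial_eq, C_1, one_mul, map_finsuppProd, map_finsuppProd, Finsupp.prod_fintype _ _ (fun i => by simp)]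
    refine Finset.prod_congr rfl fun i _ => ?_
    rw [map_pow, map_pow, Literature.AlgebraicGeometry.Resolution.taylor_X, map_add, map_C, map_X, eval_X]
  rw [key, coeff_map, ← Literature.AlgebraicGeometry.Resolution.hasseDeriv_apply,
    Literature.AlgebraicGeometry.Resolution.hasseDeriv_monomial, map_mul, map_natCast]
  congr 1
  rw [monomial_eq, C_1, one_mul, map_finsuppProd, Finsupp.prod_fintype _ _ (fun i => by simp)]
  refine Finset.prod_congr rfl fun i _ => ?_
  rw [map_pow, eval_X, Finsupp.tsub_apply]

end HasseSchmidt

end Summit.ResolutionOfSingularities.KangarooAtlas.Mizutani
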